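import Mathlib.Algebra.BigOperators.Group.Finset.Basic
import Mathlib.Data.Set.Pairwise.Basic
import Mathlib.Algebra.Group.Indicator
import Mathlib.Tactic.FieldSimp
import HarnessLib

/-!
# F0 · P3c · line LH6 «StCharTS» — road (D) «DEEP-FL», brick (D-c)(α) «COSET-SUM»: the finite-sum bookkeeping of the refined `H`-test function
# `f_H⁰ = Σ_j c_j · 𝟙_{K u_j K}` against two-coset orbital values

Cell `pub/hodgecm-mathlib`, crux H413 = `stmt-HodgeConjecture-24833` (lane `--supports … --as helper`), route HCCMUnconditional; seat LH6-p03 (g0) = road (D) owner of record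
(ROAD-D status v5 `F0/P3b/LH6-p03/g0/ROAD-D.status.v5.txt`, OPEN item (α)).  THEOREMS ONLY, sorry-free, Mathlib-only imports; no definition ∕ instance ∕ notation ∕ named fact.
HONEST LABEL: HC_CM is proved only modulo the 7 printed citations (2 remaining: hLiu418 = stmt-HodgeConjecture-24832, h413 = stmt-HodgeConjecture-24833) until rung 0 closes;
count-neutral plumbing of road (D).

THE MATHEMATICS (pure algebra; [Rogawski1990, §4.9 (4.9.4) p. 56, §12.7 L. 12.7.3 p. 195] is where it is consumed).  The D3-ii closed forms (★ p849606 G, ★ p849562 H) give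
each summand's orbital value at a torus point `t` in the TWO-COSET shape `O_t(𝟙_{K u_j K}) = p(t) · κ_j · (𝟙_{C_j}(t) + κ′ · 𝟙_{C′_j}(t))` (`C_j = u_j S′` the coset, `C′_j` its
Weyl flip, `p(t)` a `j`-independent prefactor `δ^{−1/2}(t)·J(t)`).  For the refined test function `f_H⁰ = Σ_{j∈s} c_j 𝟙_{K u_j K}` over a PAIRWISE DISJOINT coset family `{C_j}`
all of whose flips `C′_j` avoid every `C_i` (the flips lie in the other shell — ROAD-D v5 CHANGE 1), linearity of the orbital integral (★ `classOrbitalIntegral_finset_sum`,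
★ `orbitalIntegral_smul`) reduces `O_t(f_H⁰)` to the finite sum treated here: it equals `c_{j₀} · p(t) · κ_{j₀}` at `t ∈ C_{j₀}` (`sum_twoCoset_eq_of_mem`), `c_{j₀}·p(t)·κ_{j₀}·κ′`
at `t ∈ C′_{j₀}` when the flips are pairwise disjoint too (`sum_twoCoset_eq_of_mem_flip`), and `0` off `⋃_j (C_j ∪ C′_j)` (`sum_twoCoset_eq_zero_of_forall_not_mem`).  Both the
`if`-form and the `Set.indicator`-form are given.

## References
* [Rogawski1990] J. D. Rogawski, *Automorphic Representations of Unitary Groups in Three Variables*, Ann. of Math. Stud. 123 (1990): §4.9 (4.9.4) p. 56; §12.7 L. 12.7.3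
  (proof) p. 195.
-/

set_option autoImplicit false
-- the mandated namespace has the single-problem summit's repeated segment (`HodgeConjecture.HodgeConjecture`)
set_option linter.dupNamespace false

open Finset

namespace Summit.HodgeConjecture.HodgeConjecture.Cruxes.H413.F0P3cStCharTSCosetSum

variable {X ι R : Type*} [CommRing R]

/-! ## §1 The `if`-form -/

open scoped Classical in
/-- **COSET-SUM at a point of the `j₀`-th coset**: `Σ_{j∈s} c_j · (p · κ_j · (𝟙_{C_j}(t) + κ′ 𝟙_{C′_j}(t))) = c_{j₀} · (p · κ_{j₀})` for `t ∈ C_{j₀}`, the `C_j` pairwise disjoint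
on `s` and every flip `C′_j` disjoint from every `C_i`. [cite: Rogawski1990, §4.9 (4.9.4) p. 56] -/
theorem sum_twoCoset_eq_of_mem (s : Finset ι) (C C' : ι → Set X) (c κ : ι → R) (κ' p : R)
    (hC : (s : Set ι).PairwiseDisjoint C) (hCC' : ∀ i ∈ s, ∀ j ∈ s, Disjoint (C i) (C' j)) {j₀ : ι} (hj₀ : j₀ ∈ s) {t : X} (ht : t ∈ C j₀) :
    ∑ j ∈ s, c j * (p * κ j * ((if t ∈ C j then 1 else 0) + κ' * (if t ∈ C' j then 1 else 0))) = c j₀ * (p * κ j₀) := by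
  rw [← Finset.add_sum_erase s _ hj₀]
  have h1 : ∀ j ∈ s.erase j₀, c j * (p * κ j * ((if t ∈ C j then 1 else 0) + κ' * (if t ∈ C' j then 1 else 0))) = 0 := by
    intro j hj
    obtain ⟨hne, hjs⟩ := Finset.mem_erase.1 hj
    have htC : t ∉ C j := fun h => (Set.disjoint_left.1 (hC hj₀ hjs hne.symm) ht) h
    have htC' : t ∉ C' j := fun h => (Set.disjoint_left.1 (hCC' j₀ hj₀ j hjs) ht) h
    rw [if_neg htC, if_neg htC', mul_zero, add_zero, mul_zero, mul_zero]
  have h0' : t ∉ C' j₀ := fun h => (Set.disjoint_left.1 (hCC' j₀ hj₀ j₀ hj₀) ht) h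
  rw [Finset.sum_eq_zero h1, add_zero, if_pos ht, if_neg h0', mul_zero, add_zero, mul_one]

open scoped Classical in
/-- **COSET-SUM at a point of the `j₀`-th flipped coset**: `= c_{j₀} · (p · κ_{j₀} · κ′)` for `t ∈ C′_{j₀}` when moreover the flips are pairwise disjoint on `s`.
[cite: Rogawski1990, §4.9 (4.9.4) p. 56] -/
theorem sum_twoCoset_eq_of_mem_flip (s : Finset ι) (C C' : ι → Set X) (c κ : ι → R) (κ' p : R)
    (hC' : (s : Set ι).PairwiseDisjoint C') (hCC' : ∀ i ∈ s, ∀ j ∈ s, Disjoint (C i) (C' j)) {j₀ : ι} (hj₀ : j₀ ∈ s) {t : X} (ht : t ∈ C' j₀) :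
    ∑ j ∈ s, c j * (p * κ j * ((if t ∈ C j then 1 else 0) + κ' * (if t ∈ C' j then 1 else 0))) = c j₀ * (p * κ j₀ * κ') := by
  rw [← Finset.add_sum_erase s _ hj₀]
  have h1 : ∀ j ∈ s.erase j₀, c j * (p * κ j * ((if t ∈ C j then 1 else 0) + κ' * (if t ∈ C' j then 1 else 0))) = 0 := by
    intro j hj
    obtain ⟨hne, hjs⟩ := Finset.mem_erase.1 hj
    have htC : t ∉ C j := fun h => (Set.disjoint_right.1 (hCC' j hjs j₀ hj₀) ht) h
    have htC' : t ∉ C' j := fun h => (Set.disjoint_left.1 (hC' hj₀ hjs hne.symm) ht) h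
    rw [if_neg htC, if_neg htC', mul_zero, add_zero, mul_zero, mul_zero]
  have h0 : t ∉ C j₀ := fun h => (Set.disjoint_right.1 (hCC' j₀ hj₀ j₀ hj₀) ht) h
  rw [Finset.sum_eq_zero h1, add_zero, if_neg h0, if_pos ht, zero_add, mul_one]

open scoped Classical in
/-- **COSET-SUM off the support**: the sum vanishes at any `t` outside every `C_j` and every `C′_j`, `j ∈ s`. [cite: Rogawski1990, §4.9 (4.9.4) p. 56] -/
theorem sum_twoCoset_eq_zero_of_forall_not_mem (s : Finset ι) (C C' : ι → Set X) (c κ : ι → R) (κ' p : R) {t : X}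
    (ht : ∀ j ∈ s, t ∉ C j) (ht' : ∀ j ∈ s, t ∉ C' j) :
    ∑ j ∈ s, c j * (p * κ j * ((if t ∈ C j then 1 else 0) + κ' * (if t ∈ C' j then 1 else 0))) = 0 :=
  Finset.sum_eq_zero fun j hj => by rw [if_neg (ht j hj), if_neg (ht' j hj), mul_zero, add_zero, mul_zero, mul_zero]

/-! ## §2 The `Set.indicator`-form -/

/-- `𝟙_C(t)` as an indicator of the constant function `1`. [cite: Rogawski1990, §4.9 (4.9.4) p. 56] -/
theorem indicator_one_apply (C : Set X) (t : X) [Decidable (t ∈ C)] :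
    C.indicator (1 : X → R) t = if t ∈ C then 1 else 0 := by
  rw [Set.indicator_apply, Pi.one_apply]

open scoped Classical in
/-- **COSET-SUM, indicator form, at a point of the `j₀`-th coset.** [cite: Rogawski1990, §4.9 (4.9.4) p. 56] -/
theorem sum_twoCoset_indicator_eq_of_mem (s : Finset ι) (C C' : ι → Set X) (c κ : ι → R) (κ' p : R)
    (hC : (s : Set ι).PairwiseDisjoint C) (hCC' : ∀ i ∈ s, ∀ j ∈ s, Disjoint (C i) (C' j)) {j₀ : ι} (hj₀ : j₀ ∈ s) {t : X} (ht : t ∈ C j₀) :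
    ∑ j ∈ s, c j * (p * κ j * ((C j).indicator (1 : X → R) t + κ' * (C' j).indicator (1 : X → R) t)) = c j₀ * (p * κ j₀) := by
  simp only [indicator_one_apply]
  exact sum_twoCoset_eq_of_mem s C C' c κ κ' p hC hCC' hj₀ ht

open scoped Classical in
/-- **COSET-SUM, indicator form, at a point of the `j₀`-th flipped coset.** [cite: Rogawski1990, §4.9 (4.9.4) p. 56] -/
theorem sum_twoCoset_indicator_eq_of_mem_flip (s : Finset ι) (C C' : ι → Set X) (c κ : ι → R) (κ' p : R)
    (hC' : (s : Set ι).PairwiseDisjoint C') (hCC' : ∀ i ∈ s, ∀ j ∈ s, Disjoint (C i) (C' j)) {j₀ : ι} (hj₀ : j₀ ∈ s) {t : X} (ht : t ∈ C' j₀) :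
    ∑ j ∈ s, c j * (p * κ j * ((C j).indicator (1 : X → R) t + κ' * (C' j).indicator (1 : X → R) t)) = c j₀ * (p * κ j₀ * κ') := by
  simp only [indicator_one_apply]
  exact sum_twoCoset_eq_of_mem_flip s C C' c κ κ' p hC' hCC' hj₀ ht

open scoped Classical in
/-- **COSET-SUM, indicator form, off the support.** [cite: Rogawski1990, §4.9 (4.9.4) p. 56] -/
theorem sum_twoCoset_indicator_eq_zero_of_forall_not_mem (s : Finset ι) (C C' : ι → Set X) (c κ : ι → R) (κ' p : R) {t : X}
    (ht : ∀ j ∈ s, t ∉ C j) (ht' : ∀ j ∈ s, t ∉ C' j) :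
    ∑ j ∈ s, c j * (p * κ j * ((C j).indicator (1 : X → R) t + κ' * (C' j).indicator (1 : X → R) t)) = 0 := by
  simp only [indicator_one_apply]
  exact sum_twoCoset_eq_zero_of_forall_not_mem s C C' c κ κ' p ht ht'

/-! ## §3 The per-coset constant solves the pointwise identity -/

/-- **Choice of `c_j`**: if `κ_{j₀}` is invertible and `c_{j₀} := D_{j₀} · g · κ_{j₀}⁻¹` (ROAD-D v5: `c_j = Δ‴(u_j)·κ_G∕κ_H(u_j)`), then the COSET-SUM value `c_{j₀}·(p·κ_{j₀})`
equals the `G`-side `D_{j₀} · (p · g)` — the pointwise form of `hlevi` on the `j₀`-th coset once `Δ‴(t) = D_{j₀}` there (★ DeltaCosetConst).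
[cite: Rogawski1990, §4.9 (4.9.4) p. 56; §12.7 L. 12.7.3 p. 195] -/
theorem perCoset_value_eq {K : Type*} [Field K] (D g κ₀ p : K) (hκ₀ : κ₀ ≠ 0) :
    D * g * κ₀⁻¹ * (p * κ₀) = D * (p * g) := by
  field_simp

end Summit.HodgeConjecture.HodgeConjecture.Cruxes.H413.F0P3cStCharTSCosetSum
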